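import Summits.HodgeConjecture.HodgeConjecture.Theses.PadicSemiregularLift

/-!
# Route PadicSemiregularLift — Assembly (item stmt-HodgeConjecture-1336)

The assembly item of route `route-HodgeConjecture-PadicSemiregularLift` is the implication

`HodgeAbelianVarieties → HodgeFermatVarieties → HodgeBeyondAnchors → HodgeConjecture`.

Since the route repair of 2026-08-15 (rev 9) the third antecedent `HodgeBeyondAnchors` is stated in
COMPLEMENT-OF-ANCHORS form (the Hodge conjecture for every smooth projective `n`-fold `X/ℂ` that is
neither the underlying variety `A.X` of an `n`-dimensional complex abelian variety nor a Fermat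
hypersurface), so the assembly is no longer the tautology `fun hA hF hG n X hX => hG hA hF hX` of the
original planner sketch: it is the case split "abelian anchor / Fermat anchor / the rest", exactly
as in the route's deciding theorem
`Summit.HodgeConjecture.HodgeConjecture.Theses.PadicSemiregularLift.closes` (which derives
`HodgeFermatVarieties` from the engine items first and then performs the same split). Pure logic;
no mechanism content.
-/

-- `Summit.HodgeConjecture.HodgeConjecture.…` repeats the summit name by the D-0017 layout (Sub = Summit).
set_option linter.dupNamespace false

namespace Summit.HodgeConjecture.HodgeConjecture.Theorems

open Summit.HodgeConjecture.HodgeConjecture.Theses.PadicSemiregularLift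

/-- **Assembly of route PadicSemiregularLift** (item stmt-HodgeConjecture-1336): the Hodge
conjecture for complex abelian varieties (`HodgeAbelianVarieties`), for complex Fermat
hypersurfaces (`HodgeFermatVarieties`) and for every smooth projective variety that is neither
(`HodgeBeyondAnchors`, complement-of-anchors form) together give the Hodge conjecture
(`_root_.HodgeConjecture`), by the case split on whether the given smooth projective `n`-fold
`X/ℂ` is `A.X` for an `n`-dimensional abelian variety `A`, a Fermat hypersurface `x₀^m + ⋯ +
x_{n+1}^m = 0`, or neither. -/
theorem padicSemiregularLift_assembly_proof : Assembly := by
  unfold Assembly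
  intro h₁ h₂ h₃ n X hX
  by_cases hAb : ∃ A : Literature.AlgebraicGeometry.Motives.AbelianVariety ℂ, A.dim = n ∧ A.X = X
  · obtain ⟨A, rfl, rfl⟩ := hAb
    exact h₁ A
  · by_cases hFe : ∃ m : ℕ, Literature.AlgebraicGeometry.Motives.IsFermatVariety n m X
    · obtain ⟨m, hm⟩ := hFe
      exact h₂ n m X hm hX
    · push Not at hAb hFe
      exact h₃ hX hAb hFe

end Summit.HodgeConjecture.HodgeConjecture.Theorems
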